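import Literature.MathematicalPhysics.PowerSystems.DVOCStabilityCondition
import HarnessLib

/-!
# The collective-amplitude gate for the reduced dVOC network: Lemma 1 of Groß–Colombino–Brouillon–
# Dörfler 2019 as an exact identity («Lemma 1♯»), the `α`-reduced decrease inequality, and
# Proposition 3's decrease on the region `Ω(ℓ, ε₁)` (every `N`, every gain `α ≥ 0`)

Topic `Literature/MathematicalPhysics/PowerSystems`, namespace
`Literature.MathematicalPhysics.PowerSystems.DvocReduced` (continues `DVOCReducedNetworkLyapunov.lean` /
`DVOCStabilityCondition.lean`: the parameter record `DvocReduced N` of the printed REDUCED-ORDER model (17)).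
THREE COLUMNS: everything here is MODELLED-column mathematics about model (17) (`N` ideal dVOC sources on a
Kron-reduced quasi-steady-state network, uniform gain `α`); no declaration says that a converter, feeder or
grid is stable. 0 named facts, 0 `decide`, no instance data; every statement PROVED from the tree's
definitions (`qS`, `normS2`, `projS`, `embS`, `sig₁/sig₂`, `Lam`, `Phi/PhiVec`, `eθ`, `gVec`, `field`,
`IsSolutionOn`, `DecreaseOnS`, `V`). First of four modules (… `Gate` → `Dynamics` → `Barrier` → `Region`).

Written for the venture ladder GRIDFUSION, cell G2-SCALE (lead §58 D74: idea card «idea-2 (cycle 5) /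
collective-amplitude-gate-printed-gain-certificate», HOME/IDEAS-G2.md; author of the scratch derivation
gridfusion-g2-idea-2, `toy-g5/GateSketch.lean` 0e78210d9569b0b4 / `port/DVOCCollectiveAmplitudeGate.lean`
9a6b39836e226557, checked rc 0 by gridfusion-g2-crit-1 STATUS l.10609–10610 / l.10675); typed for the tree by
gridfusion-lit-4 (g15), 2026-08-28, from the pages cited below.

## Sources (read on the page; `pNNNN Ln` = PDF page / line of the arXiv rendering)

* [GrossEtAl2019] D. Groß, M. Colombino, J.-S. Brouillon, F. Dörfler, *The effect of transmission-line
  dynamics on grid-forming dispatchable virtual oscillator control*, IEEE TCNS 6 (2019) 1148–1160 =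
  arXiv:1802.08881: §IV-D p0006 L37–46 (the matrix `S := [v_1⋆R(θ_11⋆)ᵀ … v_N⋆R(θ_1N⋆)ᵀ]ᵀ` and «the
  projector `P_S := (I_2N − (1/Σ v_i⋆²) S Sᵀ)` onto the nullspace of `S`»), the amplitude set
  `𝒜 = {v | ‖v_k‖ = v_k⋆ ∀k}` and `𝒯` (16) p0005 L2–9; Lemma 1 (22) p0006 L70–72; Lemma 2 (23) L73–77;
  Proposition 3 (24)–(25) L82–100 and its proof (26)–(27) L114–121; Theorem 2 p0005 L69–76; proof of
  Lemma 1 p0011 L113–118.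

> [Lemma 1, p0006 L70–72] «The following inequality holds for all v ∈ ℝ^{2N}:
> vᵀ P_S Φ(v) v ≤ vᵀ P_S v = ‖v‖²_S (22).»
> [proof of Lemma 1, p0011 L113–118] «Since vᵀP_SΦ(v)v = vᵀP_Sv − vᵀ diag({‖v_k‖²/v_k⋆² I₂}_{k=1}^N) P_S v,
> the inequality (22) is equivalent to vᵀ diag({‖v_k‖²/v_k⋆² I₂}) P_S v ≥ 0, ∀v.»
> [proof of Prop. 3, p0006 L114–121] «d/dt V = η vᵀP_S((𝒦 − 𝓛)v + αΦ(v)v) − 2η²αα₁ vᵀΦ(v)((𝒦 − 𝓛)v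
> + αΦ(v)v) (26). Using Lemma 1, we can bound (26) as d/dt V ≤ η vᵀP_S(𝒦 − 𝓛 + αI_2N)v − … (27).»

## What is printed and what is this file's

PRINTED: Lemma 1 (22) (an inequality), Lemma 2 (23) (typed in the tree as `DecreaseOnS c`), Prop. 3 (25)
(typed as `hasDerivWithinAt_V_le` / `normS2_le_exp_decay` under `DecreaseOnS c` at the FULL gain `α`).
THIS FILE (the idea card's refinement, proved): write `v = s(v) + P_S v` with `s(v) := S Sᵀ v/Λ ∈ 𝒮`
(`syncPart`), so that every node of `s(v)` has the common normalised amplitude `r(v)`, `‖s(v)_k‖² =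
r(v)² v_k⋆²` (`rSq`, `nsq_syncPart`); with the radial disagreements `a_k := ⟨s_k, (P_S v)_k⟩` (`radDis`,
`Σ_k a_k = 0`) and `b_k := ‖(P_S v)_k‖²` the printed identity of the proof of Lemma 1 becomes the EXACT
**Lemma 1♯** `vᵀP_SΦ(v)v = (1 − r²)‖v‖²_S − Σ_k (2a_k + b_k)(a_k + b_k)/v_k⋆²` (`qS_PhiVec_eq`; printed
Lemma 1 keeps only `≤ ‖v‖²_S`), hence the GATE BOUND `vᵀP_SΦ(v)v ≤ (1 − r² + ε₂)‖v‖²_S` whenever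
`b_k ≤ 8ε₂ v_k⋆²` (`qS_PhiVec_le_gate`). Consequently the `V₁ = ½‖v‖²_S` part of (26)–(27) needs (23) only
at the REDUCED gain `α(ε₁ + ε₂)` on the gate `{1 − r² ≤ ε₁} ∩ {b_k ≤ 8ε₂v_k⋆²}`: `GateDecrease c ε` is
LITERALLY `DecreaseOnS c` of the same data with `α ↦ αε` (`gateDecrease_iff_decreaseOnS`, `Iff.rfl` — no new
certificate format), and **Prop. 3♯** `vᵀP_S g(v) ≤ −c‖v‖²_S` holds on the gate (`qS_gVec_le_of_gate`) and on
the region `Ω(ℓ, ε₁) = {½‖P_Sv‖² ≤ ℓ} ∩ {r² ≥ 1 − ε₁}` with `ε₂ = ℓ/(4v_min²)` (`qS_gVec_le_of_region`),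
for EVERY `α ≥ 0` and every `N`; integrated along a solution that RESIDES in the gate,
`‖v(t)‖²_S ≤ e^{−2ηct}‖v(0)‖²_S` (`normS2_le_exp_decay_of_gate`; residence is the business of the `Region`
module). SOS-type remark: Prop. 3♯ is sufficient, not necessary; `Ω` is an inner region, O(1) in `N`
(the step `b_k ≤ ‖v‖²_S` caps `ℓ`). The record's statements about (23) AS PRINTED at a given gain are
untouched by anything here. Nothing in this file certifies a real grid.
-/

noncomputable section

namespace Literature.MathematicalPhysics.PowerSystems

open Finset Real

namespace DvocReduced

variable {N : ℕ} (W : DvocReduced N)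

/-- Squared COLLECTIVE AMPLITUDE ratio `r(v)² := ‖Sᵀv‖²/Λ²` of the `𝒮`-component of `v`
(`v − P_S v = S(σ₁(v)/Λ, σ₂(v)/Λ)` and `‖(v − P_S v)_k‖² = r(v)² v_k⋆²`, cf. the tree's `nsq_embS`);
`r = 1` on `𝒮 ∩ 𝒜`. [cite: GrossEtAl2019, §IV-D p0006 L37–46 (`S`, `P_S`, `Λ = Σ v_i⋆²`) and (16) p0005 L2–9 (`𝒜`)] -/
def rSq (v : DvocState N) : ℝ :=
  (W.sig₁ v / W.Lam) ^ 2 + (W.sig₂ v / W.Lam) ^ 2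

/-- The `𝒮`-component `s(v) := v − P_S v = S Sᵀ v / Λ` (the complement of the printed projector `P_S`).
[cite: GrossEtAl2019, §IV-D p0006 L44–46] -/
def syncPart (v : DvocState N) : DvocState N :=
  W.embS (W.sig₁ v / W.Lam) (W.sig₂ v / W.Lam)

/-- Radial disagreement at node `k`: `a_k(v) := ⟨s(v)_k, (P_S v)_k⟩` (this file's coordinate; `Σ_k a_k = 0`).
[cite: GrossEtAl2019, §IV-D p0006 L44–46 (`P_S`)] -/
def radDis (v : DvocState N) (k : Fin N) : ℝ :=
  (W.syncPart v).1 k * (W.projS v).1 k + (W.syncPart v).2 k * (W.projS v).2 k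

/-- `v = s(v) + P_S v` componentwise. [cite: GrossEtAl2019, §IV-D p0006 L44–46] -/
theorem syncPart_add_projS (v : DvocState N) (k : Fin N) :
    (W.syncPart v).1 k + (W.projS v).1 k = v.1 k ∧ (W.syncPart v).2 k + (W.projS v).2 k = v.2 k := by
  simp [syncPart, projS]

/-- `‖s(v)_k‖² = r(v)² v_k⋆²`: every node of the `𝒮`-component has the common normalised amplitude `r(v)`.
[cite: GrossEtAl2019, §IV-D p0006 L37–46] -/
theorem nsq_syncPart (v : DvocState N) (k : Fin N) :
    dvocNsq (W.syncPart v) k = W.rSq v * W.vref k ^ 2 := by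
  unfold syncPart rSq
  rw [W.nsq_embS]
  ring

-- `qS_eq_dot_projS : W.qS u x = dvocDot (W.projS u) x` is the tree's (DVOCStabilityCondition §1).

/-- `Σ_k a_k(v) = ⟨s(v), P_S v⟩ = 0` (the `𝒮`-component is orthogonal to the projection).
[cite: GrossEtAl2019, §IV-D p0006 L44–46 («the projector P_S … onto the nullspace of S»)] -/
theorem sum_radDis (hΛ : W.Lam ≠ 0) (v : DvocState N) : ∑ k, W.radDis v k = 0 := by
  have h : ∑ k, W.radDis v k = dvocDot (W.projS v) (W.syncPart v) := by
    simp only [radDis, dvocDot]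
    exact Finset.sum_congr rfl fun k _ => by ring
  obtain ⟨h1, h2⟩ := W.sig_projS hΛ v
  rw [h, syncPart, W.dot_embS, h1, h2]
  ring

/-- Pointwise value of `Φ_k = 1 − ‖v_k‖²/v_k⋆²` in gate coordinates: `Φ_k(v) = 1 − r² − (2a_k + b_k)/v_k⋆²`,
`b_k = ‖(P_S v)_k‖²`. [cite: GrossEtAl2019, proof of Lemma 1 p0011 L113–118 (the `diag(‖v_k‖²/v_k⋆²)` term)] -/
theorem Phi_eq_gate (v : DvocState N) {k : Fin N} (hk : W.vref k ≠ 0) :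
    W.Phi v k = 1 - W.rSq v - (2 * W.radDis v k + dvocNsq (W.projS v) k) / W.vref k ^ 2 := by
  obtain ⟨e1, e2⟩ := W.syncPart_add_projS v k
  have hs := W.nsq_syncPart v k
  unfold dvocNsq at hs
  unfold Phi dvocNsq radDis
  rw [← e1, ← e2]
  field_simp
  linear_combination (-1 : ℝ) * hs

/-- **Lemma 1♯ (identity).** `vᵀ P_S Φ(v) v = (1 − r²)‖v‖²_S − Σ_k (2a_k + b_k)(a_k + b_k)/v_k⋆²` — the
printed `vᵀP_SΦ(v)v = vᵀP_Sv − vᵀdiag(‖v_k‖²/v_k⋆²)P_Sv` with the diagonal term expanded in `(r, a_k, b_k)`;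
printed Lemma 1 (22) is the inequality `≤ ‖v‖²_S`. [cite: GrossEtAl2019, Lemma 1 (22) p0006 L70–72 and its proof p0011 L113–118] -/
theorem qS_PhiVec_eq (hΛ : W.Lam ≠ 0) (hne : ∀ k, W.vref k ≠ 0) (v : DvocState N) :
    W.qS v (W.PhiVec v) = (1 - W.rSq v) * W.normS2 v
      - ∑ k, (2 * W.radDis v k + dvocNsq (W.projS v) k)
          * (W.radDis v k + dvocNsq (W.projS v) k) / W.vref k ^ 2 := by
  -- `vᵀP_SΦ(v)v = Σ_k Φ_k ⟨δ_k, v_k⟩ = Σ_k Φ_k (a_k + b_k)`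
  have h1 : W.qS v (W.PhiVec v) = ∑ k, W.Phi v k * (W.radDis v k + dvocNsq (W.projS v) k) := by
    rw [W.qS_eq_dot_projS]
    simp only [dvocDot, PhiVec]
    refine Finset.sum_congr rfl fun k _ => ?_
    obtain ⟨e1, e2⟩ := W.syncPart_add_projS v k
    unfold radDis dvocNsq
    rw [← e1, ← e2]
    ring
  rw [h1, W.normS2_eq_sum_nsq_projS hΛ, Finset.mul_sum, ← Finset.sum_sub_distrib]
  have hsum := W.sum_radDis hΛ v
  -- add `(1 − r²) Σ_k a_k = 0` to the right-hand side
  have : ∑ k, W.Phi v k * (W.radDis v k + dvocNsq (W.projS v) k)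
      = ∑ k, ((1 - W.rSq v) * dvocNsq (W.projS v) k
          - (2 * W.radDis v k + dvocNsq (W.projS v) k) * (W.radDis v k + dvocNsq (W.projS v) k)
              / W.vref k ^ 2) + (1 - W.rSq v) * ∑ k, W.radDis v k := by
    rw [Finset.mul_sum, ← Finset.sum_add_distrib]
    refine Finset.sum_congr rfl fun k _ => ?_
    rw [W.Phi_eq_gate v (hne k)]
    field_simp
    ring
  rw [this, hsum, mul_zero, add_zero]

/-- **Lemma 1♯ (gate bound).** If `‖(P_S v)_k‖² ≤ 8 ε₂ v_k⋆²` for all `k`, then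
`vᵀ P_S Φ(v) v ≤ (1 − r(v)² + ε₂) ‖v‖²_S` (complete the square `2a² + 3ab + b² ≥ −b²/8`); printed Lemma 1
(22) is the case «`≤ 1·‖v‖²_S`». [cite: GrossEtAl2019, Lemma 1 (22) p0006 L70–72] -/
theorem qS_PhiVec_le_gate (hΛ : W.Lam ≠ 0) (hne : ∀ k, W.vref k ≠ 0) (v : DvocState N) {ε₂ : ℝ}
    (hδ : ∀ k, dvocNsq (W.projS v) k ≤ 8 * ε₂ * W.vref k ^ 2) :
    W.qS v (W.PhiVec v) ≤ (1 - W.rSq v + ε₂) * W.normS2 v := by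
  rw [W.qS_PhiVec_eq hΛ hne v, W.normS2_eq_sum_nsq_projS hΛ]
  have key : ∀ k, -((2 * W.radDis v k + dvocNsq (W.projS v) k)
      * (W.radDis v k + dvocNsq (W.projS v) k) / W.vref k ^ 2) ≤ ε₂ * dvocNsq (W.projS v) k := by
    intro k
    have hvk := hne k
    have hv2 : 0 < W.vref k ^ 2 := by positivity
    have hb : 0 ≤ dvocNsq (W.projS v) k := by unfold dvocNsq; positivity
    rw [neg_le, le_div_iff₀ hv2]
    -- `−ε₂ b v² ≤ (2a+b)(a+b)` from `(2a+b)(a+b) ≥ −b²/8 ≥ −ε₂ b v*²`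
    nlinarith [sq_nonneg (4 * W.radDis v k + 3 * dvocNsq (W.projS v) k), hδ k]
  have hs : -(∑ k, (2 * W.radDis v k + dvocNsq (W.projS v) k)
      * (W.radDis v k + dvocNsq (W.projS v) k) / W.vref k ^ 2) ≤ ε₂ * ∑ k, dvocNsq (W.projS v) k := by
    rw [← Finset.sum_neg_distrib, Finset.mul_sum]
    exact Finset.sum_le_sum fun k _ => key k
  linarith

/-- The `α`-REDUCED decrease inequality: the printed (23) `vᵀP_S(𝒦 − 𝓛 + αI)v ≤ −c‖v‖²_S` with `α`
replaced by `α·ε`, i.e. `vᵀ P_S e_θ(v) + α ε ‖v‖²_S ≤ −c ‖v‖²_S` for all `v`; for `ε = 1` this is the tree's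
`DecreaseOnS c`. A predicate on the network data, not a named fact. [cite: GrossEtAl2019, Lemma 2 (23) p0006 L73–77] -/
def GateDecrease (c ε : ℝ) : Prop :=
  ∀ v : DvocState N, W.qS v (W.eθ v) + W.α * ε * W.normS2 v ≤ -c * W.normS2 v

/-- `GateDecrease c ε` is LITERALLY the printed (23) for the same network data with gain `α ε`: no new
certificate format (any kernel object deciding `DecreaseOnS`, evaluated at `α := α ε`). [cite: GrossEtAl2019, Lemma 2 (23) p0006 L73–77] -/
theorem gateDecrease_iff_decreaseOnS (c ε : ℝ) :
    W.GateDecrease c ε ↔ ({ W with α := W.α * ε } : DvocReduced N).DecreaseOnS c := Iff.rfl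

/-- `ε = 1`: the reduced inequality is the printed one. [cite: GrossEtAl2019, Lemma 2 (23) p0006 L73–77] -/
theorem gateDecrease_one_iff (c : ℝ) : W.GateDecrease c 1 ↔ W.DecreaseOnS c := by
  simp [GateDecrease, DecreaseOnS]

/-- Monotonicity of the reduced-gain inequality in the budget `ε` (for `α ≥ 0`, `Λ ≠ 0`): a certificate at
budget `ε` serves every `ε' ≤ ε`. [cite: GrossEtAl2019, Lemma 2 (23) p0006 L73–77] -/
theorem gateDecrease_mono (hΛ : W.Lam ≠ 0) (hα : 0 ≤ W.α) {c ε ε' : ℝ} (h : W.GateDecrease c ε)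
    (hle : ε' ≤ ε) : W.GateDecrease c ε' := by
  intro v
  have h0 := W.normS2_nonneg hΛ v
  have := h v
  nlinarith [mul_le_mul_of_nonneg_left hle (mul_nonneg hα h0)]

/-- **Proposition 3♯ (decrease on the gate).** Under the `α`-reduced inequality with `ε = ε₁ + ε₂`, at every
state of the gate `{1 − r(v)² ≤ ε₁} ∩ {‖(P_S v)_k‖² ≤ 8ε₂ v_k⋆² ∀k}`: `vᵀ P_S g(v) ≤ −c ‖v‖²_S`,
`g = e_θ + αΦ(v)v` — the `V₁ = ½‖v‖²_S` part of the printed step (26)–(27) with Lemma 1 replaced by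
Lemma 1♯; valid for EVERY `α ≥ 0` (sufficient, not necessary). [cite: GrossEtAl2019, Prop. 3 proof (26)–(27) p0006 L114–121] -/
theorem qS_gVec_le_of_gate (hΛ : W.Lam ≠ 0) (hne : ∀ k, W.vref k ≠ 0) (hα : 0 ≤ W.α)
    {c ε₁ ε₂ : ℝ} (h23 : W.GateDecrease c (ε₁ + ε₂)) (v : DvocState N)
    (hr : 1 - W.rSq v ≤ ε₁) (hδ : ∀ k, dvocNsq (W.projS v) k ≤ 8 * ε₂ * W.vref k ^ 2) :
    W.qS v (W.gVec v) ≤ -c * W.normS2 v := by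
  rw [W.qS_gVec]
  have h1 := W.qS_PhiVec_le_gate hΛ hne v hδ
  have h2 := h23 v
  have hn : 0 ≤ W.normS2 v := W.normS2_nonneg hΛ v
  have h3 : W.α * W.qS v (W.PhiVec v) ≤ W.α * ((ε₁ + ε₂) * W.normS2 v) := by
    refine mul_le_mul_of_nonneg_left (h1.trans ?_) hα
    exact mul_le_mul_of_nonneg_right (by linarith) hn
  linarith


/-! ## The region `Ω(ℓ, ε₁) = {½‖P_S v‖² ≤ ℓ} ∩ {r² ≥ 1 − ε₁}` implies the per-node gate -/

/-- A single node's share of the sync-distance: `‖(P_S v)_k‖² ≤ ‖v‖²_S = Σ_j ‖(P_S v)_j‖²` (the 2-norm →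
per-node step that makes `Ω` an O(1)-in-`N` region). [cite: GrossEtAl2019, §IV-D p0006 L44–46 (`‖v‖²_S = vᵀP_Sv`)] -/
theorem nsq_projS_le_normS2 (hΛ : W.Lam ≠ 0) (v : DvocState N) (k : Fin N) :
    dvocNsq (W.projS v) k ≤ W.normS2 v := by
  rw [W.normS2_eq_sum_nsq_projS hΛ]
  exact Finset.single_le_sum (f := fun j => dvocNsq (W.projS v) j)
    (fun j _ => by unfold dvocNsq; positivity) (Finset.mem_univ k)

/-- Inside `Ω(ℓ, ε₁)` the per-node gate holds with `ε₂ = ℓ/(4 v_min²)`: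
`‖(P_S v)_k‖² ≤ ‖v‖²_S ≤ 2ℓ ≤ 8 ε₂ v_k⋆²` (`v_k⋆ ≥ v_min > 0`). [cite: GrossEtAl2019, §IV-D p0006 L44–46] -/
theorem gate_of_region (hΛ : W.Lam ≠ 0) {vmin ℓ : ℝ} (hvmin : 0 < vmin)
    (hv : ∀ k, vmin ≤ W.vref k) (v : DvocState N) (hV : W.normS2 v ≤ 2 * ℓ) (k : Fin N) :
    dvocNsq (W.projS v) k ≤ 8 * (ℓ / (4 * vmin ^ 2)) * W.vref k ^ 2 := by
  have h1 := W.nsq_projS_le_normS2 hΛ v k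
  have hvk : vmin ^ 2 ≤ W.vref k ^ 2 := by
    have h := hv k
    nlinarith [mul_le_mul h h hvmin.le (hvmin.le.trans h)]
  have h0 : 0 ≤ dvocNsq (W.projS v) k := by unfold dvocNsq; positivity
  have hℓ : 0 ≤ ℓ := by linarith
  have hv2 : 0 < vmin ^ 2 := by positivity
  calc dvocNsq (W.projS v) k ≤ 2 * ℓ := h1.trans hV
    _ = 8 * (ℓ / (4 * vmin ^ 2)) * vmin ^ 2 := by field_simp; ring
    _ ≤ 8 * (ℓ / (4 * vmin ^ 2)) * W.vref k ^ 2 := by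
        apply mul_le_mul_of_nonneg_left hvk
        positivity

/-- **Prop 3♯ on the region `Ω(ℓ, ε₁)`**: if (23) holds at the reduced gain `α(ε₁ + ℓ/(4v_min²))` with margin
`c`, then at every state with `½‖P_S v‖² ≤ ℓ` and `r(v)² ≥ 1 − ε₁`: `vᵀ P_S g(v) ≤ −c‖v‖²_S` — for every
`α ≥ 0` and every `N` (MODELLED model (17); a pointwise statement, no trajectory). [cite: GrossEtAl2019, Prop. 3 proof (26)–(27) p0006 L114–121] -/
theorem qS_gVec_le_of_region (hΛ : W.Lam ≠ 0) (hα : 0 ≤ W.α) {vmin ℓ ε₁ c : ℝ}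
    (hvmin : 0 < vmin) (hv : ∀ k, vmin ≤ W.vref k)
    (h23 : W.GateDecrease c (ε₁ + ℓ / (4 * vmin ^ 2))) (v : DvocState N)
    (hV : 1 / 2 * W.normS2 v ≤ ℓ) (hr : 1 - W.rSq v ≤ ε₁) :
    W.qS v (W.gVec v) ≤ -c * W.normS2 v := by
  have hne : ∀ k, W.vref k ≠ 0 := fun k => (hvmin.trans_le (hv k)).ne'
  exact W.qS_gVec_le_of_gate hΛ hne hα h23 v hr
    (W.gate_of_region hΛ hvmin hv v (by linarith) )

/-- **Along solutions** (the ODE sentence, reusing the tree's derivative of the printed (19) with `α₁ = 0`, so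
that `V = ½‖v‖²_S`): at any time where a solution of (17) sits in the gate, `d/dt ½‖v(t)‖²_S ≤ −η c ‖v(t)‖²_S`.
[cite: GrossEtAl2019, Prop. 3 (25)–(27) p0006 L96–121] -/
theorem hasDerivWithinAt_halfNormS2_le_of_gate (hΛ : W.Lam ≠ 0) (hne : ∀ k, W.vref k ≠ 0)
    (hη : 0 ≤ W.η) (hα : 0 ≤ W.α) {c ε₁ ε₂ : ℝ} (h23 : W.GateDecrease c (ε₁ + ε₂))
    {γ : ℝ → DvocState N} {s : Set ℝ} {t : ℝ} (hγ : HasDerivWithinAt γ (W.field (γ t)) s t)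
    (hr : 1 - W.rSq (γ t) ≤ ε₁) (hδ : ∀ k, dvocNsq (W.projS (γ t)) k ≤ 8 * ε₂ * W.vref k ^ 2) :
    ∃ d : ℝ, HasDerivWithinAt (fun τ => W.V 0 (γ τ)) d s t ∧ d ≤ -(W.η * c) * W.normS2 (γ t) := by
  refine ⟨W.Vdot 0 (γ t), W.hasDerivWithinAt_V 0 hγ, ?_⟩
  have h := W.qS_gVec_le_of_gate hΛ hne hα h23 (γ t) hr hδ
  simp only [Vdot, mul_zero, zero_mul, sub_zero]
  nlinarith


/-- **Integrated decrease from a pointwise inequality along the trajectory** (the tree's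
`normS2_le_exp_decay`, which assumes the printed (23) `DecreaseOnS c`, with its use of (23) replaced by the
pointwise hypothesis `vᵀP_S g(v) ≤ −c‖v‖²_S` AT THE VISITED STATES only): for `η ≥ 0` and a solution of
(17) on `[0, T]`, `‖v(t)‖²_S ≤ e^{−2ηct}‖v(0)‖²_S` on `[0, T]` (`t ↦ e^{2ηct}·½‖v(t)‖²_S` is antitone).
A priori statement in the tree's solution convention (no existence claim).
[cite: GrossEtAl2019, Prop. 3 (25) p0006 L96–100 and its proof (26)–(27) L114–121] -/
theorem normS2_le_exp_decay_of_pointwise (hη : 0 ≤ W.η) {c : ℝ}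
    {γ : ℝ → DvocState N} {T : ℝ} (hsol : W.IsSolutionOn γ (Set.Icc 0 T))
    (hpt : ∀ τ ∈ Set.Icc 0 T, W.qS (γ τ) (W.gVec (γ τ)) ≤ -c * W.normS2 (γ τ))
    {t : ℝ} (ht : t ∈ Set.Icc 0 T) :
    W.normS2 (γ t) ≤ Real.exp (-(2 * W.η * c * t)) * W.normS2 (γ 0) := by
  set k : ℝ := 2 * W.η * c with hk
  have hd : ∀ τ ∈ Set.Icc 0 T, HasDerivWithinAt
      (fun σ => Real.exp (k * σ) * (1 / 2 * W.normS2 (γ σ)))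
      (Real.exp (k * τ) * (k * 1) * (1 / 2 * W.normS2 (γ τ))
        + Real.exp (k * τ) * (W.η * W.qS (γ τ) (W.gVec (γ τ)))) (Set.Icc 0 T) τ := by
    intro τ hτ
    have he : HasDerivWithinAt (fun σ => Real.exp (k * σ)) (Real.exp (k * τ) * (k * 1))
        (Set.Icc 0 T) τ :=
      (((hasDerivAt_id τ).const_mul k).exp).hasDerivWithinAt
    exact he.mul (W.hasDerivWithinAt_half_normS2 (hsol τ hτ))
  have hanti : AntitoneOn (fun σ => Real.exp (k * σ) * (1 / 2 * W.normS2 (γ σ))) (Set.Icc 0 T) := by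
    refine antitoneOn_of_hasDerivWithinAt_nonpos
      (f' := fun τ => Real.exp (k * τ) * (k * 1) * (1 / 2 * W.normS2 (γ τ))
        + Real.exp (k * τ) * (W.η * W.qS (γ τ) (W.gVec (γ τ))))
      (convex_Icc 0 T) (fun τ hτ => (hd τ hτ).continuousWithinAt)
      (fun τ hτ => (hd τ (interior_subset hτ)).mono interior_subset) (fun τ hτ => ?_)
    have hτ' : τ ∈ Set.Icc 0 T := interior_subset hτ
    have hq := hpt τ hτ'
    have he0 : 0 < Real.exp (k * τ) := Real.exp_pos _
    have hin : W.η * (c * W.normS2 (γ τ) + W.qS (γ τ) (W.gVec (γ τ))) ≤ 0 :=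
      mul_nonpos_iff.2 (Or.inl ⟨hη, by linarith⟩)
    have key : Real.exp (k * τ) * (k * 1) * (1 / 2 * W.normS2 (γ τ))
        + Real.exp (k * τ) * (W.η * W.qS (γ τ) (W.gVec (γ τ)))
        = Real.exp (k * τ) * (W.η * (c * W.normS2 (γ τ) + W.qS (γ τ) (W.gVec (γ τ)))) := by
      rw [hk]; ring
    rw [key]
    exact mul_nonpos_iff.2 (Or.inl ⟨he0.le, hin⟩)
  have h0 : (0 : ℝ) ∈ Set.Icc 0 T := Set.left_mem_Icc.2 (ht.1.trans ht.2)
  have hmono := hanti h0 ht ht.1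
  simp only [mul_zero, Real.exp_zero, one_mul] at hmono
  have he0 : 0 < Real.exp (-(k * t)) := Real.exp_pos _
  have hprod : Real.exp (-(k * t)) * Real.exp (k * t) = 1 := by
    rw [← Real.exp_add, neg_add_cancel, Real.exp_zero]
  calc W.normS2 (γ t) = Real.exp (-(k * t)) * (Real.exp (k * t) * W.normS2 (γ t)) := by
        rw [← mul_assoc, hprod, one_mul]
    _ ≤ Real.exp (-(k * t)) * W.normS2 (γ 0) := by
        apply mul_le_mul_of_nonneg_left _ he0.le
        linarith
    _ = Real.exp (-(2 * W.η * c * t)) * W.normS2 (γ 0) := by rw [hk]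

/-- **Regional exponential phase stability on the gate (integrated form, every `N`, every `α ≥ 0`).**
If a solution of (17) on `[0, T]` RESIDES in the gate `{1 − r² ≤ ε₁} ∩ {‖(P_S v)_k‖² ≤ 8ε₂ v_k⋆² ∀k}` and
the `α`-reduced inequality holds with margin `c` at `ε = ε₁ + ε₂`, then `‖v(t)‖²_S ≤ e^{−2ηct}‖v(0)‖²_S`
on `[0, T]` — the printed (25) integrated, with (23) at gain `α(ε₁+ε₂)` in place of (23) at gain `α`.
CONDITIONAL ON RESIDENCE (supplied by the `Region` module); a priori (no existence claim).
[cite: GrossEtAl2019, Prop. 3 (25) p0006 L96–100] -/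
theorem normS2_le_exp_decay_of_gate (hΛ : W.Lam ≠ 0) (hne : ∀ k, W.vref k ≠ 0)
    (hη : 0 ≤ W.η) (hα : 0 ≤ W.α) {c ε₁ ε₂ : ℝ} (h23 : W.GateDecrease c (ε₁ + ε₂))
    {γ : ℝ → DvocState N} {T : ℝ} (hsol : W.IsSolutionOn γ (Set.Icc 0 T))
    (hgate : ∀ τ ∈ Set.Icc 0 T, 1 - W.rSq (γ τ) ≤ ε₁ ∧
      ∀ k, dvocNsq (W.projS (γ τ)) k ≤ 8 * ε₂ * W.vref k ^ 2)
    {t : ℝ} (ht : t ∈ Set.Icc 0 T) :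
    W.normS2 (γ t) ≤ Real.exp (-(2 * W.η * c * t)) * W.normS2 (γ 0) :=
  W.normS2_le_exp_decay_of_pointwise hη hsol
    (fun τ hτ => W.qS_gVec_le_of_gate hΛ hne hα h23 (γ τ) (hgate τ hτ).1 (hgate τ hτ).2) ht

/-- `V 0 = ½‖·‖²_S`: with `α₁ = 0` the printed Lyapunov function (19) is the pure sync-distance term.
[cite: GrossEtAl2019, (19) p0006 L46–55] -/
theorem V_zero_weight (v : DvocState N) : W.V 0 v = 1 / 2 * W.normS2 v := by
  simp [V]

end DvocReduced

end Literature.MathematicalPhysics.PowerSystems
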